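import Mathlib
import Summits.AnomalousDissipation.AnomalousDissipation.Theorems.SolenoidalFractalHomogenisationLagrangianStepW7SlotStepR
import HarnessLib

/-!
# K1L_D (stmt-AnomalousDissipation-27980), (ℓ3) (D-TH) — TOOLS FOR THE BAND STEP: per-chain pointwise inequality, slack absorption, band rate, sandwich constants,
# absolute continuity of finite sums (pure real analysis) (helper; `--supports stmt-AnomalousDissipation-27980 --as helper`)

Engine addition (E-b1)+(E-b2) promised in `HOME/ad-sawtooth-k1loc-p1/g16/DTH-premise-answer-k1locp1g16.md` §4 (answer to L24 §5 / RULING D28-22 (3), trigger (T-b)); prover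
ad-sawtooth-k1loc-p1 g16.  `W7Slot.slot_stepR` (p725843) runs ONE chain with the whole energy as `E`; a variable frame couples the chains of a band through zero-order
forcing terms, which enter the functional ONLY through the cross terms and must be absorbed ACROSS chains (memo §3).  This file is the frame-agnostic real-analysis
object the un-freezing glue ((D-TH)₁, lead L24) instantiates:
* a finite index set `ι` of slow chains `q0 i, qp i, qm i` (real wave vectors) with modes `w0 i, wp i, wm i, wpp i, wmm i`, GENERIC dampings `y_j i` and FORCING terms
  `f0 i, fp i, fm i` in the chain ODE (`ẇ₀ = dW0R + f₀`, …), link constants `c i ∈ [cbar, chi]`, drain floors `qd i ≥ qbar`, slow coercivities `d0 i`, a COMMON `ε`,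
  ONE energy `E` with `E' = −2Q`, the dissipation split over ALL chains `Q ≥ μ Σ_i Σ_j Re⟪y_j i, w_j i⟫ + (dmin/2)(E − μ Σ_i Σ_j ‖w_j i‖²)`;
* the functional `Φ = E + μ·ε·Σ_i X_i`, `X_i = (c i·A)·Re⟪w₀ⁱ, P₀ⁱ(w₊ⁱ − w₋ⁱ)⟫`;
* the FORCING HYPOTHESIS in summed, explicitly shaped slack form (a.e. on the slot):
  `μ ε Σ_i (c i·A)·(‖f₀ⁱ‖(‖w₊ⁱ‖+‖w₋ⁱ‖) + ‖w₀ⁱ‖(‖f₊ⁱ‖+‖f₋ⁱ‖)) ≤ μ Σ_i (ε (c i)² (qd i) A²/4·‖w₀ⁱ‖² + (dmin/8)(‖w₊ⁱ‖²+‖w₋ⁱ‖²)) + (dmin/8)·(E − μ Σ_i Σ_j ‖w_j i‖²)`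
  — half of the slow gain, an eighth of the `±`/rest dissipation; this is what Cauchy–Schwarz across chains delivers for couplings of size θ×(chain transport) and
  θ×(dissipation) under `θ ≤ qbar/(4C)`, `θ² ≤ qbar/2` (memo §3);
* CONCLUSION `band_step` (companion file `…W7BandStep`).
THIS FILE: the pure real-analysis bricks — `pointwise_chain_ineq` (the per-chain core of `W7Slot.pointwise_slot_ineq` WITHOUT the rest term: form + ramp Young + drain),
`chain_slack_le` (adding the explicitly shaped forcing slack leaves the coefficients `ρ̄, 7dmin/8, dtwo`), `min_rate_le` (the band rate, no sign condition on `ρ̄`),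
`eps_c_sqrt_two_le` / `sandwich_term_le` (the `7E/8 ≤ Φ ≤ 9E/8` constants).  (Finite sums of absolutely continuous functions: `CellChain.absolutelyContinuousOnInterval_finsetSum`, already in the tree.)
No definitions, no sorry.  NOT a proof of any block, of `stub_W7thg`, of K1L_D or of AD; rung F-D1.A0.
[cite: BedrossianCotiZelati2017, §2 (hypocoercivity functional with a cross term, Grönwall)] [problem: turb]
-/

set_option linter.dupNamespace false

noncomputable section

namespace Summit.AnomalousDissipation.AnomalousDissipation.Theorems.SolenoidalFractalHomogenisation.LagrangianStep.W7Slot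

open Set Real MeasureTheory intervalIntegral
open scoped InnerProductSpace
open Literature.Analysis.FluidPDE Literature.Analysis.FluidPDE.Torus
open Summit.AnomalousDissipation.AnomalousDissipation.Theorems.SolenoidalFractalHomogenisation.LagrangianStep.ThreeMode
open Summit.AnomalousDissipation.AnomalousDissipation.Theorems.SolenoidalFractalHomogenisation.LagrangianStep.W7Engine

/-! ## §1 The per-chain pointwise inequality (form + ramp + drain; no rest term) -/

/-- **Per-chain pointwise inequality.**  At one instant, for ONE chain: the three-mode form inequality (`hform`), the drain floor `q‖w₀‖² ≤ Q̂(w₀)`, the ramp pairing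
`|Y| ≤ ‖w₀‖(‖w₊‖+‖w₋‖)` and `Ȧ² ≤ 4/T²` give
`μ(−2S + ε·x + ε·c·Ȧ·Y) ≤ −μ·εc²(qA²/2 − 8ε/(dmin T²))·‖w₀‖² − μ·dmin(‖w₊‖²+‖w₋‖²) − μ·dtwo(‖w₊₊‖²+‖w₋₋‖²)`. [cite: BedrossianCotiZelati2017, §2] -/
theorem pointwise_chain_ineq {μ ε c q dmin dtwo d0 A Ad T x Qh Y S n0 np nm npp nmm : ℝ}
    (hμ : 0 < μ) (hε : 0 ≤ ε) (hc : 0 ≤ c) (hdmin : 0 < dmin) (hd0 : 0 ≤ d0) (hT : 0 < T)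
    (hform : -2 * S + ε * x ≤ -(ε * (c * A) ^ 2 / 2) * Qh - (5 * dmin / 4) * (np ^ 2 + nm ^ 2)
        - dtwo * (npp ^ 2 + nmm ^ 2) - (7 * d0 / 4) * n0 ^ 2)
    (hqh : q * n0 ^ 2 ≤ Qh) (hY : |Y| ≤ n0 * (np + nm)) (hAd : Ad ^ 2 ≤ 4 / T ^ 2) :
    μ * (-2 * S + ε * x + ε * (c * Ad) * Y)
      ≤ -(μ * (ε * c ^ 2 * (q * A ^ 2 / 2 - 8 * ε / (dmin * T ^ 2))) * n0 ^ 2) - μ * dmin * (np ^ 2 + nm ^ 2) - μ * dtwo * (npp ^ 2 + nmm ^ 2) := by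
  -- the ramp term by Young against `dmin/4` of the `±1` dissipation
  have hεc : 0 ≤ ε * c := mul_nonneg hε hc
  have h3a : ε * (c * Ad) * Y ≤ ε * c * |Ad| * (n0 * (np + nm)) := by
    have : ε * (c * Ad) * Y ≤ |ε * (c * Ad) * Y| := le_abs_self _
    rw [abs_mul, abs_mul, abs_of_nonneg hε, abs_mul, abs_of_nonneg hc] at this
    calc ε * (c * Ad) * Y ≤ ε * (c * |Ad|) * |Y| := this
      _ ≤ ε * (c * |Ad|) * (n0 * (np + nm)) := mul_le_mul_of_nonneg_left hY (by positivity)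
      _ = ε * c * |Ad| * (n0 * (np + nm)) := by ring
  have hyoung : ∀ b : ℝ, ε * c * |Ad| * n0 * b ≤ (dmin / 4) * b ^ 2 + (ε ^ 2 * c ^ 2 * Ad ^ 2 / dmin) * n0 ^ 2 := by
    intro b
    have hsq : 0 ≤ (dmin / 2 * b - ε * c * |Ad| * n0) ^ 2 / dmin := div_nonneg (sq_nonneg _) hdmin.le
    have hexp : (dmin / 2 * b - ε * c * |Ad| * n0) ^ 2 / dmin
        = (dmin / 4) * b ^ 2 - ε * c * |Ad| * n0 * b + (ε ^ 2 * c ^ 2 * |Ad| ^ 2 / dmin) * n0 ^ 2 := by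
      field_simp
      ring
    rw [hexp, sq_abs] at hsq
    linarith
  have h3 : ε * (c * Ad) * Y ≤ (dmin / 4) * (np ^ 2 + nm ^ 2) + (8 * ε ^ 2 * c ^ 2 / (dmin * T ^ 2)) * n0 ^ 2 := by
    have hp' := hyoung np
    have hm' := hyoung nm
    have hAd' : (ε ^ 2 * c ^ 2 * Ad ^ 2 / dmin) * n0 ^ 2 ≤ (4 * ε ^ 2 * c ^ 2 / (dmin * T ^ 2)) * n0 ^ 2 := by
      apply mul_le_mul_of_nonneg_right _ (sq_nonneg _)
      rw [div_le_div_iff₀ hdmin (by positivity)]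
      have : ε ^ 2 * c ^ 2 * Ad ^ 2 * (dmin * T ^ 2) = (ε ^ 2 * c ^ 2 * dmin) * (Ad ^ 2 * T ^ 2) := by ring
      rw [this]
      have hAT : Ad ^ 2 * T ^ 2 ≤ 4 := by
        have := mul_le_mul_of_nonneg_right hAd (sq_nonneg T)
        rwa [div_mul_cancel₀ _ (by positivity)] at this
      have := mul_le_mul_of_nonneg_left hAT (by positivity : 0 ≤ ε ^ 2 * c ^ 2 * dmin)
      linarith
    calc ε * (c * Ad) * Y ≤ ε * c * |Ad| * (n0 * (np + nm)) := h3a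
      _ = ε * c * |Ad| * n0 * np + ε * c * |Ad| * n0 * nm := by ring
      _ ≤ (dmin / 4) * np ^ 2 + (ε ^ 2 * c ^ 2 * Ad ^ 2 / dmin) * n0 ^ 2
          + ((dmin / 4) * nm ^ 2 + (ε ^ 2 * c ^ 2 * Ad ^ 2 / dmin) * n0 ^ 2) := add_le_add hp' hm'
      _ ≤ (dmin / 4) * (np ^ 2 + nm ^ 2) + (8 * ε ^ 2 * c ^ 2 / (dmin * T ^ 2)) * n0 ^ 2 := by
          have e8 : (8 * ε ^ 2 * c ^ 2 / (dmin * T ^ 2)) * n0 ^ 2 = 2 * ((4 * ε ^ 2 * c ^ 2 / (dmin * T ^ 2)) * n0 ^ 2) := by ring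
          rw [e8]; linarith [hAd']
  -- the drain floor and the slow coefficient
  have h4 : -(ε * (c * A) ^ 2 / 2) * Qh ≤ -(ε * c ^ 2 * q * A ^ 2 / 2) * n0 ^ 2 := by
    have hk : 0 ≤ ε * (c * A) ^ 2 / 2 := by positivity
    have h := mul_le_mul_of_nonneg_left hqh hk
    have e : ε * (c * A) ^ 2 / 2 * (q * n0 ^ 2) = (ε * c ^ 2 * q * A ^ 2 / 2) * n0 ^ 2 := by ring
    rw [e] at h
    linarith
  have hd0n : 0 ≤ (7 * d0 / 4) * n0 ^ 2 := by positivity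
  have hsum : -2 * S + ε * x + ε * (c * Ad) * Y
      ≤ -(ε * c ^ 2 * (q * A ^ 2 / 2 - 8 * ε / (dmin * T ^ 2))) * n0 ^ 2 - dmin * (np ^ 2 + nm ^ 2) - dtwo * (npp ^ 2 + nmm ^ 2) := by
    have e : -(ε * c ^ 2 * (q * A ^ 2 / 2 - 8 * ε / (dmin * T ^ 2))) * n0 ^ 2
        = -(ε * c ^ 2 * q * A ^ 2 / 2) * n0 ^ 2 + (8 * ε ^ 2 * c ^ 2 / (dmin * T ^ 2)) * n0 ^ 2 := by ring
    rw [e]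
    linarith [hform, h3, h4, hd0n]
  have := mul_le_mul_of_nonneg_left hsum hμ.le
  have e2 : μ * (-(ε * c ^ 2 * (q * A ^ 2 / 2 - 8 * ε / (dmin * T ^ 2))) * n0 ^ 2 - dmin * (np ^ 2 + nm ^ 2) - dtwo * (npp ^ 2 + nmm ^ 2))
      = -(μ * (ε * c ^ 2 * (q * A ^ 2 / 2 - 8 * ε / (dmin * T ^ 2))) * n0 ^ 2) - μ * dmin * (np ^ 2 + nm ^ 2) - μ * dtwo * (npp ^ 2 + nmm ^ 2) := by ring
  linarith [e2]

/-- Per-chain slack absorption: adding the explicitly shaped forcing slack `μ(εc²qA²/4·‖w₀‖² + (dmin/8)·P)` to the chain inequality leaves the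
coefficients `ρ̄ ≤ εc²qA²/4 − 8ε²c²/(dmin T²)`, `7dmin/8`, `dtwo`. -/
theorem chain_slack_le {μ ε c q dmin dtwo A T ρbar n0sq P PP L : ℝ} (hμ : 0 ≤ μ) (hn0 : 0 ≤ n0sq)
    (hL : L ≤ -(μ * (ε * c ^ 2 * (q * A ^ 2 / 2 - 8 * ε / (dmin * T ^ 2))) * n0sq) - μ * dmin * P - μ * dtwo * PP)
    (hρ : ρbar ≤ ε * c ^ 2 * q * A ^ 2 / 4 - 8 * ε ^ 2 * c ^ 2 / (dmin * T ^ 2)) :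
    L + μ * (ε * c ^ 2 * q * A ^ 2 / 4 * n0sq + dmin / 8 * P) ≤ -(ρbar * (μ * n0sq)) - (7 * dmin / 8) * (μ * P) - dtwo * (μ * PP) := by
  have key := mul_le_mul_of_nonneg_right hρ (mul_nonneg hμ hn0)
  have e : -(μ * (ε * c ^ 2 * (q * A ^ 2 / 2 - 8 * ε / (dmin * T ^ 2))) * n0sq) + μ * (ε * c ^ 2 * q * A ^ 2 / 4 * n0sq)
      = -((ε * c ^ 2 * q * A ^ 2 / 4 - 8 * ε ^ 2 * c ^ 2 / (dmin * T ^ 2)) * (μ * n0sq)) := by ring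
  have e2 : μ * (ε * c ^ 2 * q * A ^ 2 / 4 * n0sq + dmin / 8 * P) = μ * (ε * c ^ 2 * q * A ^ 2 / 4 * n0sq) + dmin / 8 * (μ * P) := by ring
  have e3 : μ * dmin * P = dmin * (μ * P) := by ring
  have e4 : μ * dtwo * PP = dtwo * (μ * PP) := by ring
  linarith [key, e, e2, e3, e4]

/-- The band rate: `−ρ̄X − aP − bPP ≤ −min(ρ̄, min(a,b))·(X + P + PP)` for `X, P, PP ≥ 0` (no sign condition on `ρ̄`). -/
theorem min_rate_le {ρbar a b X P PP : ℝ} (hX : 0 ≤ X) (hP : 0 ≤ P) (hPP : 0 ≤ PP) :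
    -(ρbar * X) - a * P - b * PP ≤ -(min ρbar (min a b)) * (X + P + PP) := by
  have h1 : min ρbar (min a b) ≤ ρbar := min_le_left _ _
  have h2 : min ρbar (min a b) ≤ a := (min_le_right _ _).trans (min_le_left _ _)
  have h3 : min ρbar (min a b) ≤ b := (min_le_right _ _).trans (min_le_right _ _)
  have p1 := mul_le_mul_of_nonneg_right h1 hX
  have p2 := mul_le_mul_of_nonneg_right h2 hP
  have p3 := mul_le_mul_of_nonneg_right h3 hPP
  linarith

/-- `εc√2/2 ≤ 1/8` from the Young caps (c1), (c2) and `dmin ≤ Dmax` (the sandwich constant of the slot step). -/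
theorem eps_c_sqrt_two_le {ε c dmin Dmax : ℝ} (hε : 0 ≤ ε) (hc : 0 ≤ c) (hdmin : 0 < dmin) (hdD : dmin ≤ Dmax)
    (c1 : 8 * ε * c ^ 2 ≤ dmin) (c2 : 4 * ε * Dmax ^ 2 ≤ dmin) : ε * c * Real.sqrt 2 / 2 ≤ 1 / 8 := by
  have hDmax : 0 < Dmax := lt_of_lt_of_le hdmin hdD
  have h32 : 32 * (ε * c) ^ 2 ≤ 1 := by
    have h1 : (8 * ε * c ^ 2) * (4 * ε * Dmax ^ 2) ≤ dmin * dmin := mul_le_mul c1 c2 (by positivity) hdmin.le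
    have h2 : dmin * dmin ≤ Dmax * Dmax := mul_le_mul hdD hdD hdmin.le hDmax.le
    have e : (8 * ε * c ^ 2) * (4 * ε * Dmax ^ 2) = (32 * (ε * c) ^ 2) * Dmax ^ 2 := by ring
    have h3 : (32 * (ε * c) ^ 2) * Dmax ^ 2 ≤ 1 * Dmax ^ 2 := by
      rw [← e]; calc _ ≤ dmin * dmin := h1
        _ ≤ Dmax * Dmax := h2
        _ = 1 * Dmax ^ 2 := by ring
    exact le_of_mul_le_mul_right h3 (by positivity : (0:ℝ) < Dmax ^ 2)
  have hs : Real.sqrt 2 ^ 2 = 2 := Real.sq_sqrt (by norm_num)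
  have hnn : 0 ≤ ε * c * Real.sqrt 2 / 2 := by positivity
  have hx : (ε * c * Real.sqrt 2 / 2) ^ 2 ≤ (1 / 8) ^ 2 := by
    have e : (ε * c * Real.sqrt 2 / 2) ^ 2 = (ε * c) ^ 2 * (Real.sqrt 2 ^ 2) / 4 := by ring
    rw [e, hs]; linarith
  exact (pow_le_pow_iff_left₀ hnn (by norm_num) two_ne_zero).1 hx

/-- The per-chain sandwich term: from the cross-term equivalence `2|εX| ≤ ε(cA)√2(n₀²+n₊²+n₋²)`, `A ≤ 1` and `εc√2/2 ≤ 1/8`: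
`|εX| ≤ (1/8)(n₀²+n₊²+n₋²+n₊₊²+n₋₋²)`. -/
theorem sandwich_term_le {ε c A X n0 np nm npp nmm : ℝ} (hε : 0 ≤ ε) (hc : 0 ≤ c) (hA1 : A ≤ 1)
    (h3 : 2 * |ε * X| ≤ ε * (c * A) * Real.sqrt 2 * (n0 ^ 2 + np ^ 2 + nm ^ 2)) (hεc : ε * c * Real.sqrt 2 / 2 ≤ 1 / 8) :
    |ε * X| ≤ 1 / 8 * (n0 ^ 2 + np ^ 2 + nm ^ 2 + npp ^ 2 + nmm ^ 2) := by
  have hE3 : n0 ^ 2 + np ^ 2 + nm ^ 2 ≤ n0 ^ 2 + np ^ 2 + nm ^ 2 + npp ^ 2 + nmm ^ 2 := by nlinarith [sq_nonneg npp, sq_nonneg nmm]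
  have hpos : 0 ≤ n0 ^ 2 + np ^ 2 + nm ^ 2 := by positivity
  have hcA : ε * (c * A) * Real.sqrt 2 ≤ ε * c * Real.sqrt 2 := by
    have h1 : c * A ≤ c := mul_le_of_le_one_right hc hA1
    exact mul_le_mul_of_nonneg_right (mul_le_mul_of_nonneg_left h1 hε) (Real.sqrt_nonneg 2)
  have hk : 0 ≤ ε * c * Real.sqrt 2 := by positivity
  have s1 := mul_le_mul_of_nonneg_right hcA hpos
  have s2 := mul_le_mul_of_nonneg_left hE3 hk
  have s3 := mul_le_mul_of_nonneg_right hεc (le_trans hpos hE3)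
  linarith [h3, s1, s2, s3]

end Summit.AnomalousDissipation.AnomalousDissipation.Theorems.SolenoidalFractalHomogenisation.LagrangianStep.W7Slot

end
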